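import Mathlib
import Literature.MathematicalPhysics.StatisticalMechanics.MiePotential
import Literature.MathematicalPhysics.StatisticalMechanics.LennardJonesClusters
import Summits.AtomisticToContinuum.Crystallization.Theorems.ExcessDecayLiouvilleFarField
import HarnessLib

/-!
# Route `OneCentreSteepnessLadder`, item `ZeroDensityOfDefects` (stmt-AtomisticToContinuum-12886), I:
# finite-configuration bookkeeping for coercive one-centre domination

Helper file (supports `ZeroDensityOfDefects`).  Write `φ_q(r) = 2r⁻ᵠ − r⁻²ᵠ`, so that the Mie
potential is `V_q = −φ_q/(2q)` (`miePotential_eq_neg_mul_phi`) and, for a finite configuration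
`z : Fin N → ℝ³`, `2·𝓔(z) = Σᵢ Σⱼ V_q(|zᵢ − zⱼ|)` (diagonal included, `V_q(0) = 0`), i.e.
`Σᵢ Σⱼ φ_q(|zᵢ − zⱼ|) = −4q·𝓔(z)` (`sum_sum_phi_eq`).

* `sum_phi_le_sum_ite_add` — truncation of the one-centre sum at radius `R ≥ δ` in a
  `δ`-separated configuration loses at most `2048/(δ³ R^{q−3})` (`q ≥ 4`; dyadic shells,
  `ExcessDecayLiouville.sum_inv_pow_le_of_separated`).
* `defect_count_le_of_transfer` — THE DOMINATION BOOKKEEPING: if at every centre `zᵢ` the truncated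
  one-centre sum plus the transfer `Σⱼ g(zⱼ − zᵢ, Uᵢ)` is `≤ Φ + ε`, and `≤ Φ + ε − γ` at the centres
  satisfying a predicate `D`, with `g` antisymmetric (`g(zⱼ − zᵢ, Uᵢ) = −g(zᵢ − zⱼ, Uⱼ)`), then
  `γ · #{i | D i} ≤ N ε + N · 2048/(δ³R^{q−3}) + N Φ + 4q · 𝓔(z)`:
  transfers cancel in the double sum, the truncated sums are bounded below by the full ones minus
  the tail, and the full double sum is `−4q 𝓔(z)`.
* `matched_range_iff` — the `η`-matching predicate written over `S = range z` versus over indices.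

All `[folklore]`; nothing here closes an item.
-/

noncomputable section

namespace Summit.AtomisticToContinuum.Crystallization.Theorems.OneCentreSteepnessLadderZeroDensity

open scoped BigOperators
open Literature.MathematicalPhysics.StatisticalMechanics
open Summit.AtomisticToContinuum.Crystallization.Theorems.ExcessDecayLiouville
  (sum_inv_pow_le_of_separated)

/-! ## The one-centre weight `φ_q(r) = 2r⁻ᵠ − r⁻²ᵠ` -/

/-- `φ_q(r) = 2r⁻ᵠ − r⁻²ᵠ ≤ 2r⁻ᵠ` (the repulsive part only helps). [folklore] -/
theorem phi_le_two_mul (q : ℕ) (r : ℝ) : 2 * r⁻¹ ^ q - r⁻¹ ^ (2 * q) ≤ 2 * r⁻¹ ^ q := by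
  have : 0 ≤ r⁻¹ ^ (2 * q) := by rw [pow_mul]; positivity
  linarith

/-- Beyond the equilibrium distance the weight is nonnegative: `0 ≤ φ_q(r)` for `1 ≤ r`.
[folklore] -/
theorem phi_nonneg (q : ℕ) {r : ℝ} (hr : 1 ≤ r) : 0 ≤ 2 * r⁻¹ ^ q - r⁻¹ ^ (2 * q) := by
  have h0 : 0 ≤ r⁻¹ := inv_nonneg.2 (zero_le_one.trans hr)
  have h1 : r⁻¹ ≤ 1 := inv_le_one_of_one_le₀ hr
  have hu0 : 0 ≤ r⁻¹ ^ q := pow_nonneg h0 q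
  have hu1 : r⁻¹ ^ q ≤ 1 := pow_le_one₀ h0 h1
  rw [pow_mul']
  nlinarith

/-- `φ_q(0) = 0` for `q ≠ 0` (Lean's `0⁻¹ = 0`; the diagonal terms of the double sums vanish).
[folklore] -/
theorem phi_zero {q : ℕ} (hq : q ≠ 0) : 2 * (0 : ℝ)⁻¹ ^ q - (0 : ℝ)⁻¹ ^ (2 * q) = 0 := by
  rw [inv_zero, zero_pow hq, zero_pow (by omega), mul_zero, sub_zero]

/-- **`V_q = −φ_q/(2q)`**: `miePotential q r = -(1/(2q)) · (2r⁻ᵠ − r⁻²ᵠ)` (`q ≠ 0`). [folklore] -/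
theorem miePotential_eq_neg_mul_phi {q : ℕ} (hq : q ≠ 0) (r : ℝ) :
    miePotential q r = -(1 / (2 * (q : ℝ))) * (2 * r⁻¹ ^ q - r⁻¹ ^ (2 * q)) := by
  have hq' : (q : ℝ) ≠ 0 := Nat.cast_ne_zero.2 hq
  rw [miePotential_apply]
  field_simp
  ring

/-- `V_q(0) = 0` (`q ≠ 0`). [folklore] -/
theorem miePotential_zero {q : ℕ} (hq : q ≠ 0) : miePotential q 0 = 0 := by
  rw [miePotential_eq_neg_mul_phi hq, phi_zero hq, mul_zero]

/-- `V_q(r) ≥ −(1/q) r⁻ᵠ` for every `r`. [folklore] -/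
theorem neg_mul_inv_pow_le_miePotential {q : ℕ} (hq : q ≠ 0) (r : ℝ) :
    -(1 / (q : ℝ)) * r⁻¹ ^ q ≤ miePotential q r := by
  have hq' : (0 : ℝ) < q := Nat.cast_pos.2 (Nat.pos_of_ne_zero hq)
  have h2 : 0 ≤ r⁻¹ ^ (2 * q) := by rw [pow_mul]; positivity
  rw [miePotential_apply]
  have : 0 ≤ 1 / (2 * (q : ℝ)) * r⁻¹ ^ (2 * q) := by positivity
  linarith

/-! ## Double sums of a finite configuration -/

/-- **`φ_q = −2q · V_q`**: `2r⁻ᵠ − r⁻²ᵠ = -(2q) · miePotential q r` (`q ≠ 0`). [folklore] -/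
theorem phi_eq_neg_mul_miePotential {q : ℕ} (hq : q ≠ 0) (r : ℝ) :
    2 * r⁻¹ ^ q - r⁻¹ ^ (2 * q) = -(2 * (q : ℝ)) * miePotential q r := by
  have hq' : (q : ℝ) ≠ 0 := Nat.cast_ne_zero.2 hq
  rw [miePotential_apply]
  field_simp
  ring

/-- **`Σᵢ Σⱼ φ_q(|zᵢ − zⱼ|) = −4q · 𝓔_{V_q}(z)`** for a finite configuration (diagonal terms vanish).
[folklore] -/
theorem sum_sum_phi_eq {q : ℕ} (hq : q ≠ 0) {N : ℕ} (z : Fin N → EuclideanSpace ℝ (Fin 3)) :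
    ∑ i, ∑ j, (2 * (dist (z i) (z j))⁻¹ ^ q - (dist (z i) (z j))⁻¹ ^ (2 * q)) =
      -(4 * (q : ℝ)) * interactionEnergy (miePotential q) z := by
  have h2 := two_mul_interactionEnergy_eq_sum_sum (miePotential q) (miePotential_zero hq) z
  simp only [phi_eq_neg_mul_miePotential hq]
  rw [Finset.sum_congr rfl fun i _ => (Finset.mul_sum _ _ _).symm, ← Finset.mul_sum, ← h2]
  ring

/-- **Truncation error of the one-centre sum.** In a `δ`-separated finite configuration, for
`q ≥ 4` and `R ≥ δ`, the full one-centre sum at `zᵢ` exceeds its truncation at radius `R`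
by at most `2048/(δ³ R^{q−3})` (the omitted terms are `φ_q ≤ 2r⁻ᵠ` at `r > R`; dyadic shells).
[folklore] -/
theorem sum_phi_le_sum_ite_add {q : ℕ} (hq : 4 ≤ q) {δ R : ℝ} (hδ : 0 < δ) (hRδ : δ ≤ R)
    {N : ℕ} (z : Fin N → EuclideanSpace ℝ (Fin 3)) (hsep : ∀ i j, i ≠ j → δ ≤ dist (z i) (z j))
    (i : Fin N) :
    ∑ j, (2 * (dist (z i) (z j))⁻¹ ^ q - (dist (z i) (z j))⁻¹ ^ (2 * q)) ≤
      (∑ j, (if dist (z i) (z j) ≤ R then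
        (2 * (dist (z i) (z j))⁻¹ ^ q - (dist (z i) (z j))⁻¹ ^ (2 * q)) else 0)) +
        2048 / (δ ^ 3 * R ^ (q - 3)) := by
  classical
  obtain ⟨k, rfl⟩ : ∃ k, q = k + 3 := ⟨q - 3, by omega⟩
  have hk : 1 ≤ k := by omega
  rw [Nat.add_sub_cancel]
  set F := Finset.univ.filter fun j : Fin N => R < dist (z i) (z j) with hF
  -- split the full sum into the truncated part and the far part
  have hsplit : ∑ j, (2 * (dist (z i) (z j))⁻¹ ^ (k + 3) - (dist (z i) (z j))⁻¹ ^ (2 * (k + 3))) =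
      (∑ j, (if dist (z i) (z j) ≤ R then
        (2 * (dist (z i) (z j))⁻¹ ^ (k + 3) - (dist (z i) (z j))⁻¹ ^ (2 * (k + 3))) else 0)) +
      ∑ j ∈ F, (2 * (dist (z i) (z j))⁻¹ ^ (k + 3) - (dist (z i) (z j))⁻¹ ^ (2 * (k + 3))) := by
    rw [hF, Finset.sum_filter, ← Finset.sum_add_distrib]
    refine Finset.sum_congr rfl fun j _ => ?_
    by_cases hj : dist (z i) (z j) ≤ R
    · rw [if_pos hj, if_neg (not_lt.2 hj), add_zero]
    · rw [if_neg hj, if_pos (not_le.1 hj), zero_add]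
  rw [hsplit]
  gcongr
  -- the far part: `φ ≤ 2 r⁻ᵠ` termwise, then the dyadic-shell bound on the image finset
  have hinj : Set.InjOn z (F : Set (Fin N)) := by
    intro j _ j' _ hjj'
    by_contra hne
    have := hsep j j' hne
    rw [hjj', dist_self] at this
    linarith
  have hfar : ∀ a ∈ F.image z, R ≤ dist a (z i) := by
    intro a ha
    obtain ⟨j, hj, rfl⟩ := Finset.mem_image.1 ha
    rw [dist_comm]
    exact (Finset.mem_filter.1 hj).2.le
  have hsep' : ∀ a ∈ F.image z, ∀ b ∈ F.image z, a ≠ b → δ ≤ dist a b := by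
    intro a ha b hb hab
    obtain ⟨j, -, rfl⟩ := Finset.mem_image.1 ha
    obtain ⟨j', -, rfl⟩ := Finset.mem_image.1 hb
    exact hsep j j' fun h => hab (h ▸ rfl)
  have hbound := sum_inv_pow_le_of_separated (F.image z) (z i) hk hδ hRδ hsep' hfar
  rw [Finset.sum_image hinj] at hbound
  calc ∑ j ∈ F, (2 * (dist (z i) (z j))⁻¹ ^ (k + 3) - (dist (z i) (z j))⁻¹ ^ (2 * (k + 3)))
      ≤ ∑ j ∈ F, 2 * (dist (z j) (z i))⁻¹ ^ (k + 3) := by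
        refine Finset.sum_le_sum fun j _ => ?_
        rw [dist_comm (z j)]
        exact phi_le_two_mul _ _
    _ = 2 * ∑ j ∈ F, (dist (z j) (z i))⁻¹ ^ (k + 3) := by rw [Finset.mul_sum]
    _ ≤ 2 * (1024 / (δ ^ 3 * R ^ k)) := by gcongr
    _ = 2048 / (δ ^ 3 * R ^ k) := by ring

/-! ## The domination bookkeeping -/

/-- **Domination bookkeeping.** Let `z : Fin N → ℝ³` be injective and `δ`-separated, `q ≥ 4`,
`R ≥ δ`.  Suppose a transfer `g` is antisymmetric along `z`
(`g(zⱼ − zᵢ, Uᵢ) = −g(zᵢ − zⱼ, Uⱼ)`), the truncated one-centre sum plus transfer is `≤ Φ + ε` at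
every centre and `≤ Φ + ε − γ` at the centres where `D` holds.  Then
`γ · #{i | D i} ≤ N ε + N · 2048/(δ³ R^{q−3}) + N Φ + 4q 𝓔_{V_q}(z)`.
(Sum the pointwise bounds; `Σᵢ Σⱼ g(zⱼ − zᵢ, Uᵢ) = 0`; truncation costs `≤ 2048/(δ³R^{q−3})` per
centre; `Σᵢ Σⱼ φ_q = −4q 𝓔`.) [folklore] -/
theorem defect_count_le_of_transfer {q : ℕ} (hq : 4 ≤ q) {δ R : ℝ} (hδ : 0 < δ) (hRδ : δ ≤ R)
    {N : ℕ} (z : Fin N → EuclideanSpace ℝ (Fin 3)) (hz : Function.Injective z)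
    (hsep : ∀ i j, i ≠ j → δ ≤ dist (z i) (z j)) (Φ ε γ : ℝ)
    (g : EuclideanSpace ℝ (Fin 3) → Set (EuclideanSpace ℝ (Fin 3)) → ℝ)
    (U : EuclideanSpace ℝ (Fin 3) → Set (EuclideanSpace ℝ (Fin 3))) (D : Fin N → Prop)
    [DecidablePred D]
    (hanti : ∀ i j, g (z j - z i) (U (z i)) = - g (z i - z j) (U (z j)))
    (hbound : ∀ i, (∑' y : ↥(Set.range z),
        (if dist (z i) (y : EuclideanSpace ℝ (Fin 3)) ≤ R then
          (2 * (dist (z i) (y : EuclideanSpace ℝ (Fin 3)))⁻¹ ^ q -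
            (dist (z i) (y : EuclideanSpace ℝ (Fin 3)))⁻¹ ^ (2 * q)) else 0)) +
        (∑' y : ↥(Set.range z), g ((y : EuclideanSpace ℝ (Fin 3)) - z i) (U (z i))) ≤ Φ + ε)
    (hdef : ∀ i, D i → (∑' y : ↥(Set.range z),
        (if dist (z i) (y : EuclideanSpace ℝ (Fin 3)) ≤ R then
          (2 * (dist (z i) (y : EuclideanSpace ℝ (Fin 3)))⁻¹ ^ q -
            (dist (z i) (y : EuclideanSpace ℝ (Fin 3)))⁻¹ ^ (2 * q)) else 0)) +
        (∑' y : ↥(Set.range z), g ((y : EuclideanSpace ℝ (Fin 3)) - z i) (U (z i))) ≤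
          Φ + ε - γ) :
    γ * ((Finset.univ.filter D).card : ℝ) ≤
      N * ε + N * (2048 / (δ ^ 3 * R ^ (q - 3))) + N * Φ +
        4 * (q : ℝ) * interactionEnergy (miePotential q) z := by
  classical
  have hq0 : q ≠ 0 := by omega
  -- tsums over `range z` are finite sums over the indices
  have htsum : ∀ G : EuclideanSpace ℝ (Fin 3) → ℝ, ∑' y : ↥(Set.range z), G y = ∑ j, G (z j) :=
      fun G => by
    rw [tsum_range G hz, tsum_fintype]
  set A : Fin N → ℝ := fun i => ∑ j, (if dist (z i) (z j) ≤ R then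
    (2 * (dist (z i) (z j))⁻¹ ^ q - (dist (z i) (z j))⁻¹ ^ (2 * q)) else 0) with hA
  set T : Fin N → ℝ := fun i => ∑ j, g (z j - z i) (U (z i)) with hT
  have hb : ∀ i, A i + T i ≤ Φ + ε := fun i => by
    have h := hbound i
    rw [htsum (fun y => if dist (z i) y ≤ R then
      (2 * (dist (z i) y)⁻¹ ^ q - (dist (z i) y)⁻¹ ^ (2 * q)) else 0),
      htsum (fun y => g (y - z i) (U (z i)))] at h
    exact h
  have hd : ∀ i, D i → A i + T i ≤ Φ + ε - γ := fun i hi => by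
    have h := hdef i hi
    rw [htsum (fun y => if dist (z i) y ≤ R then
      (2 * (dist (z i) y)⁻¹ ^ q - (dist (z i) y)⁻¹ ^ (2 * q)) else 0),
      htsum (fun y => g (y - z i) (U (z i)))] at h
    exact h
  -- transfers cancel
  have hT0 : ∑ i, T i = 0 := by
    have h1 : ∑ i, T i = -∑ i, T i :=
      calc ∑ i, T i = ∑ i, ∑ j, -g (z i - z j) (U (z j)) :=
            Finset.sum_congr rfl fun i _ => Finset.sum_congr rfl fun j _ => hanti i j
        _ = -∑ j, ∑ i, g (z i - z j) (U (z j)) := by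
            rw [Finset.sum_comm]
            simp only [Finset.sum_neg_distrib]
        _ = -∑ i, T i := rfl
    linarith
  -- sum the pointwise bounds
  have hsum : ∑ i, (A i + T i) ≤ ∑ i, (Φ + ε - γ * (if D i then 1 else 0)) := by
    refine Finset.sum_le_sum fun i _ => ?_
    by_cases hi : D i
    · rw [if_pos hi, mul_one]; exact hd i hi
    · rw [if_neg hi, mul_zero, sub_zero]; exact hb i
  have hrhs : ∑ i, (Φ + ε - γ * (if D i then 1 else 0)) =
      N * (Φ + ε) - γ * ((Finset.univ.filter D).card : ℝ) := by
    rw [Finset.sum_sub_distrib, Finset.sum_const, Finset.card_univ, Fintype.card_fin,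
      nsmul_eq_mul, ← Finset.mul_sum, Finset.sum_boole]
  have hlhs : ∑ i, (A i + T i) = ∑ i, A i := by
    rw [Finset.sum_add_distrib, hT0, add_zero]
  -- the truncated sums dominate the full one-centre sums up to the tail
  have htail : ∀ i, ∑ j, (2 * (dist (z i) (z j))⁻¹ ^ q - (dist (z i) (z j))⁻¹ ^ (2 * q)) ≤
      A i + 2048 / (δ ^ 3 * R ^ (q - 3)) := fun i =>
    sum_phi_le_sum_ite_add hq hδ hRδ z hsep i
  have hfull := sum_sum_phi_eq hq0 z
  have hle : ∑ i, ∑ j, (2 * (dist (z i) (z j))⁻¹ ^ q - (dist (z i) (z j))⁻¹ ^ (2 * q)) ≤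
      ∑ i, A i + N * (2048 / (δ ^ 3 * R ^ (q - 3))) := by
    calc ∑ i, ∑ j, (2 * (dist (z i) (z j))⁻¹ ^ q - (dist (z i) (z j))⁻¹ ^ (2 * q))
        ≤ ∑ i, (A i + 2048 / (δ ^ 3 * R ^ (q - 3))) := Finset.sum_le_sum fun i _ => htail i
      _ = ∑ i, A i + N * (2048 / (δ ^ 3 * R ^ (q - 3))) := by
          rw [Finset.sum_add_distrib, Finset.sum_const, Finset.card_univ, Fintype.card_fin,
            nsmul_eq_mul]
  rw [hlhs, hrhs] at hsum
  linarith

/-! ## Matching predicates over `range z` versus over indices -/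

/-- The two-way `η`-matching of a neighbourhood, quantified over the point set `S = range z`,
is the same as quantified over indices. [folklore] -/
theorem matched_range_iff {N : ℕ} (z : Fin N → EuclideanSpace ℝ (Fin 3))
    (P : Set (EuclideanSpace ℝ (Fin 3))) (c η : ℝ) (x : EuclideanSpace ℝ (Fin 3))
    (A : EuclideanSpace ℝ (Fin 3) →ₗᵢ[ℝ] EuclideanSpace ℝ (Fin 3)) :
    ((∀ p ∈ P, ‖p‖ ≤ c → ∃ y ∈ Set.range z, dist y (x + A p) ≤ η) ∧
        (∀ y ∈ Set.range z, dist y x ≤ c → ∃ p ∈ P, dist y (x + A p) ≤ η)) ↔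
      ((∀ p ∈ P, ‖p‖ ≤ c → ∃ j, dist (z j) (x + A p) ≤ η) ∧
        (∀ j, dist (z j) x ≤ c → ∃ p ∈ P, dist (z j) (x + A p) ≤ η)) := by
  simp only [Set.exists_range_iff, Set.forall_mem_range]

end Summit.AtomisticToContinuum.Crystallization.Theorems.OneCentreSteepnessLadderZeroDensity

end
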